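import Summits.QuantumFields.BalabanUV.Beta.D1BFx.NeedleRowLetters

/-!
# `BalabanUV.Beta.D1BFx.ProjectorColumnSharp` — road «BF-x» for binder row D1, slot (K), END row `hGrp gN` (NEEDLES ∪ G_R), (N-1) letters
# M4 ∕ M4′ ∕ M5 of an3-g56's NEEDLE-PROFILES memo (= M3 of an1-g37's): THE SHARP, `n`-FREE BLOCK-COLUMN, FINE-`ℓ¹`-COLUMN AND `kerP`-COLUMN
# LETTERS OF BAŁABAN's GAUGE-TERM PROJECTOR ON THE ROAD — the by-name swaps for the `n⁴`∕`n²`-lossy `CornerColumnZeroMass.sum_B_abs_Pgt_le` ∕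
# `abs_kerP_col_le` ∕ `CornerJRankOne.abs_cornerJ_le`, plus the `n⁻¹` gains of the column DIFFERENCES and the combined column of the needle words

HONEST DEPENDENCY (cell records, verbatim): «continuum YM on T⁴ ⇐ BetaPertH ∧ nine spine estimates (0/9 proved); BetaPertH ⇐ (D1) ∧ (D4) ∧
CAP+tail; G-an2-4 gates asym, D1 and NE2/3/4.»  HONEST FRAMING (cell contract, verbatim): «discharging `BetaPertH` makes Bałaban's UV stability
UNCONDITIONAL — a real constructive-QFT result; it is NOT the continuum limit and NOT the Clay problem.»  THIS MODULE DISCHARGES NOTHING of the wall: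
it is [folklore] bookkeeping BY NAME over leaf A3.a-P's sharp sup-norm legs (`ProjectorSupNorm.abs_Pgt_le_sup` `cPPs·n⁻⁴`, `abs_Pgt_diff_le_sup` ∕
`abs_Pgt_diff_right_le_sup` `cPPs·n⁻⁵`, `abs_kerP_le_sup` `cPs`, `abs_kerP_diff_le_sup` `cPs∕(n+1)`, `decays_Pgt_sup`), the block count
`B6QGQLower276.sum_B_const`, the block regrouping `NeedleRowLetters.tsum_eq_tsum_blocks` and the lattice constant `RProjector.abs_tsum_le_latticeConst`.
No `def`, no `def … : Prop`, nothing cited, 0 sorry.  Asserts no bound on any word ∕ table ∕ group; nothing of Bałaban's.  Root-level binders hW ∕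
hR-sockets ∕ hSX-socket ∕ D1Tel ∕ D1Rep — 0 discharged; (K) NOT closed; NOT D1, NOT `BetaPertH`, NOT continuum, NOT Clay.

ABSOLUTE RULE (cell charter, verbatim): «No internally-minted statement may enter as a cited fact. Every hypothesis is either kernel-proved in this
package or a verbatim quotation of a PUBLISHED theorem with page reference. The manuscript(s) under audit are NOT citable for their own disputed
steps — they are the thing under adjudication; programme-internal (2001/route/tribunal) claims are never citable.»

WHY (an3-g56 (N-1) memo `HOME/b2b-balaban-beta-an3/gen56/NEEDLE-PROFILES.v1.md` 7fa163ef7e91e99e §0 (V3) «three letters (N-2) will want to reach for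
are n-LOSSY twins of sharp ones already in the tree — swap BY NAME, do not re-prove: `CornerColumnZeroMass.sum_B_abs_Pgt_le` (… O(n⁴); sharp:
`n⁴ × abs_Pgt_le_sup` = `cPPs·e^{−δ_PP·dist}`, O(1) — §3 M4), `abs_kerP_col_le` and `CornerJRankOne.abs_cornerJ_le` (constant `cP ∝ n²`; sharp:
`abs_kerP_le_sup`, `cPs` n-free — M5)», §3 M4 «`sum_B_abs_Pgt_le_sup`», M4′ «the fine-ℓ¹ column `Σ' x, |Pgt n a x q| ≤ cPPs·K₄(δ_PP)` and
`Σ' x, |Pgt (x + e μ) q − Pgt x q| ≤ cPPs∕n·K₄(δ_PP)`», M5, and §2 F-R3 «COLUMN `C q = cQ·Σ_{z∈B(blk u)} Pgt z q − kerP (n−1) a q (blk u)` …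
Differences `C(z+e_β) − C z` … both gain `n⁻¹`, by name»; an1-g37 memo §6 M3; owner d1-p2-g9 «NEEDLE-GLUE» p255957: the gluon tables T1–T3 of
`NeedleRowGlue.abs_gN_row_le_of_tables` carry `SbRc ⊃ SbRblk` whose anatomy (`SbRblkAnatomy.SbRblk_apply_road`) is written in exactly these columns).

CONTENT (all [folklore]; `d = 4`; block side `n` (`[NeZero n]`), `B = B6QGQLower276.B (n − 1)`, `blk = blk (n − 1)`; weight `0 < a`; constants
`cPPs 4 a`, `cPs 4 a`, rates `deltaPP 4 a`, `deltaP 4 a` of `ProjectorSupNorm` ∕ `RProjector` — all `n`-free).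
* §1 M4 BLOCK COLUMNS AND ROWS: **`sum_B_abs_Pgt_le_sup`** (`Σ_{z ∈ B w} |Pgt n a z q| ≤ cPPs·e^{−δ_PP·dist(w, blk q)}`), `abs_sum_B_Pgt_le_sup`, the row
  twin `sum_B_abs_Pgt_row_le_sup` (`Pgt_symm`), and the DIFFERENCES **`sum_B_abs_Pgt_diff_right_le_sup`** (`Σ_{z ∈ B w} |Pgt z (q+e_μ) − Pgt z q| ≤ (cPPs∕n)·e^{…}`),
  `sum_B_abs_Pgt_diff_le_sup` (left slot) — the block count `n⁴` against `n⁻⁴` resp. `n⁻⁵`.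
* §2 M4′ FINE-`ℓ¹` COLUMNS: `summable_abs_Pgt_col`, **`tsum_abs_Pgt_col_le_sup`** (`Σ'_x |Pgt n a x q| ≤ cPPs·K₄(δ_PP)`), `summable_abs_Pgt_diff_col`,
  **`tsum_abs_Pgt_diff_col_le_sup`** (`Σ'_x |Pgt (x+e_μ) q − Pgt x q| ≤ (cPPs∕n)·K₄(δ_PP)`).
* §3 M5 THE `kerP` COLUMN AND THE CORNER: **`abs_kerP_col_le_sup`** (`|kerP (n−1) a q w| ≤ cPs·e^{−δ_P·dist(blk q, w)}`), **`abs_kerP_col_diff_le_sup`**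
  (`≤ (cPs∕n)·e^{…}`), **`abs_cornerJ_le_sup`** (`CornerJRankOne.abs_cornerJ_le` with `cPs` for `cP 4 (n−1) a`).
* §4 THE COMBINED COLUMN OF THE NEEDLE WORDS `C_w(q) = cQ·Σ_{z ∈ B w} Pgt z q − kerP (n−1) a q w`: **`abs_combinedColumn_le_sup`**
  (`≤ |cQ|·cPPs·e^{−δ_PP·dist(w, blk q)} + cPs·e^{−δ_P·dist(blk q, w)}`) and its `q`-difference **`abs_combinedColumn_diff_le_sup`** (`≤ (|cQ|·cPPs + cPs)∕n × (same)`)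
  — the located `n⁻¹` gain sits on this slot (an3 §3 M8).
Unit `b2b-balaban-gan24-formalise-leaf-05` (gen 41), G-an2-4 swarm leaf prover on cross-lane kernel duty; `LEAVES-BFx.md` row (N) ∕ (N-1) letters M4 ∕ M4′ ∕ M5.
-/

noncomputable section

namespace Summit.QuantumFields.BalabanUV.Beta.D1BFx.ProjectorColumnSharp

open Finset
open scoped BigOperators
open Literature.MathematicalPhysics.QuantumFieldTheory.Balaban1983to89
open Literature.MathematicalPhysics.QuantumFieldTheory.Balaban1983to89.Beta
open B12Sec2to5 (l1 l1_nonneg)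
open B4Sect5Proof (latticeConst latticeConst_nonneg)
open B6QGQLower276 (X e blk B mem_B sum_B sum_B_const)
open ExpKernelCalculus (Site MKer Decays summable_exp_shift')
open RProjector (kerP Pgt Pgt_symm abs_tsum_le_latticeConst deltaP deltaPP deltaP_pos deltaPP_pos)
open ProjectorSupNorm (cPs cPPs cPs_nonneg cPPs_nonneg abs_Pgt_le_sup abs_Pgt_diff_le_sup abs_Pgt_diff_right_le_sup abs_kerP_le_sup
  abs_kerP_diff_le_sup decays_Pgt_sup)
open GhostLeg (cast_pred_add_one)
open GhostStencil (qJet)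
open RProjectorJet (RG Jq cornerJ)
open CornerJRankOne (abs_row_le cornerJ_apply_eq)
open NeedleRowLetters (tsum_eq_tsum_blocks)

variable (n : ℕ) [NeZero n] {a : ℝ}

/-! ## §1 M4 — the sharp block columns and rows of `Pgt`, and their differences -/

/-- [folklore] **M4 — THE SHARP BLOCK COLUMN OF THE PROJECTOR**: `Σ_{z ∈ B(w)} |Pgt n a z q| ≤ cPPs(4,a)·e^{−δ_PP·dist(w, blk q)}` — the `n⁴` sites of the
block against the sharp `cPPs·n⁻⁴` entry bound (`ProjectorSupNorm.abs_Pgt_le_sup`); `n`-FREE (the tree's `CornerColumnZeroMass.sum_B_abs_Pgt_le` carries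
`n⁴·cPP`). -/
theorem sum_B_abs_Pgt_le_sup (ha : 0 < a) (q w : X 4) (v v' : Unit) :
    ∑ z ∈ B (n - 1) w, |Pgt n a z q v v'| ≤ cPPs 4 a * Real.exp (-(deltaPP 4 a * dist w (blk (n - 1) q))) := by
  have hn : (0 : ℝ) < n := Nat.cast_pos.mpr (Nat.pos_of_ne_zero (NeZero.ne n))
  calc ∑ z ∈ B (n - 1) w, |Pgt n a z q v v'|
      ≤ ∑ z ∈ B (n - 1) w, cPPs 4 a / (n : ℝ) ^ 4 * Real.exp (-(deltaPP 4 a * dist w (blk (n - 1) q))) := by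
        refine Finset.sum_le_sum fun z hz => ?_
        have h := abs_Pgt_le_sup n ha z q v v'
        rwa [mem_B.1 hz] at h
    _ = ((((n - 1 : ℕ) : ℝ) + 1) ^ 4) * (cPPs 4 a / (n : ℝ) ^ 4 * Real.exp (-(deltaPP 4 a * dist w (blk (n - 1) q)))) :=
        sum_B_const w _
    _ = cPPs 4 a * Real.exp (-(deltaPP 4 a * dist w (blk (n - 1) q))) := by
        rw [cast_pred_add_one n]
        field_simp

/-- [folklore] The signed block column: `|Σ_{z ∈ B(w)} Pgt n a z q| ≤ cPPs(4,a)·e^{−δ_PP·dist(w, blk q)}`. -/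
theorem abs_sum_B_Pgt_le_sup (ha : 0 < a) (q w : X 4) (v v' : Unit) :
    |∑ z ∈ B (n - 1) w, Pgt n a z q v v'| ≤ cPPs 4 a * Real.exp (-(deltaPP 4 a * dist w (blk (n - 1) q))) :=
  (Finset.abs_sum_le_sum_abs _ _).trans (sum_B_abs_Pgt_le_sup n ha q w v v')

/-- [folklore] The block ROW (symmetry `RProjector.Pgt_symm`): `Σ_{z ∈ B(w)} |Pgt n a q z| ≤ cPPs(4,a)·e^{−δ_PP·dist(w, blk q)}`. -/
theorem sum_B_abs_Pgt_row_le_sup (ha : 0 < a) (q w : X 4) (v v' : Unit) :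
    ∑ z ∈ B (n - 1) w, |Pgt n a q z v v'| ≤ cPPs 4 a * Real.exp (-(deltaPP 4 a * dist w (blk (n - 1) q))) := by
  have h := sum_B_abs_Pgt_le_sup n ha q w v' v
  refine le_trans (le_of_eq (Finset.sum_congr rfl fun z _ => ?_)) h
  rw [Pgt_symm n ha q z v v']

/-- [folklore] **THE BLOCK COLUMN OF THE `q`-DIFFERENCE GAINS `n⁻¹`**: `Σ_{z ∈ B(w)} |Pgt n a z (q+e_μ) − Pgt n a z q| ≤ (cPPs(4,a)∕n)·e^{−δ_PP·dist(w, blk q)}`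
(`abs_Pgt_diff_right_le_sup`: `cPPs·n⁻⁵` per entry). -/
theorem sum_B_abs_Pgt_diff_right_le_sup (ha : 0 < a) (q w : X 4) (μ : Fin 4) (v v' : Unit) :
    ∑ z ∈ B (n - 1) w, |Pgt n a z (q + e μ) v v' - Pgt n a z q v v'|
      ≤ cPPs 4 a / (n : ℝ) * Real.exp (-(deltaPP 4 a * dist w (blk (n - 1) q))) := by
  have hn : (0 : ℝ) < n := Nat.cast_pos.mpr (Nat.pos_of_ne_zero (NeZero.ne n))
  calc ∑ z ∈ B (n - 1) w, |Pgt n a z (q + e μ) v v' - Pgt n a z q v v'|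
      ≤ ∑ z ∈ B (n - 1) w, cPPs 4 a / (n : ℝ) ^ 5 * Real.exp (-(deltaPP 4 a * dist w (blk (n - 1) q))) := by
        refine Finset.sum_le_sum fun z hz => ?_
        have h := abs_Pgt_diff_right_le_sup n ha z q μ v v'
        rwa [mem_B.1 hz] at h
    _ = ((((n - 1 : ℕ) : ℝ) + 1) ^ 4) * (cPPs 4 a / (n : ℝ) ^ 5 * Real.exp (-(deltaPP 4 a * dist w (blk (n - 1) q)))) :=
        sum_B_const w _
    _ = cPPs 4 a / (n : ℝ) * Real.exp (-(deltaPP 4 a * dist w (blk (n - 1) q))) := by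
        rw [cast_pred_add_one n]
        field_simp

/-- [folklore] The block column of the LEFT-slot difference: `Σ_{z ∈ B(w)} |Pgt n a (z+e_μ) q − Pgt n a z q| ≤ (cPPs(4,a)∕n)·e^{−δ_PP·dist(w, blk q)}`. -/
theorem sum_B_abs_Pgt_diff_le_sup (ha : 0 < a) (q w : X 4) (μ : Fin 4) (v v' : Unit) :
    ∑ z ∈ B (n - 1) w, |Pgt n a (z + e μ) q v v' - Pgt n a z q v v'|
      ≤ cPPs 4 a / (n : ℝ) * Real.exp (-(deltaPP 4 a * dist w (blk (n - 1) q))) := by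
  have hn : (0 : ℝ) < n := Nat.cast_pos.mpr (Nat.pos_of_ne_zero (NeZero.ne n))
  calc ∑ z ∈ B (n - 1) w, |Pgt n a (z + e μ) q v v' - Pgt n a z q v v'|
      ≤ ∑ z ∈ B (n - 1) w, cPPs 4 a / (n : ℝ) ^ 5 * Real.exp (-(deltaPP 4 a * dist w (blk (n - 1) q))) := by
        refine Finset.sum_le_sum fun z hz => ?_
        have h := abs_Pgt_diff_le_sup n ha z q μ v v'
        rwa [mem_B.1 hz] at h
    _ = ((((n - 1 : ℕ) : ℝ) + 1) ^ 4) * (cPPs 4 a / (n : ℝ) ^ 5 * Real.exp (-(deltaPP 4 a * dist w (blk (n - 1) q)))) :=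
        sum_B_const w _
    _ = cPPs 4 a / (n : ℝ) * Real.exp (-(deltaPP 4 a * dist w (blk (n - 1) q))) := by
        rw [cast_pred_add_one n]
        field_simp

/-! ## §2 M4′ — the fine-`ℓ¹` columns of `Pgt` over the whole lattice -/

/-- [folklore] The column `x ↦ |Pgt n a x q|` is summable over `ℤ⁴` (`ProjectorSupNorm.decays_Pgt_sup` against `summable_exp_shift'`). -/
theorem summable_abs_Pgt_col (ha : 0 < a) (q : X 4) (v v' : Unit) : Summable fun x : X 4 => |Pgt n a x q v v'| := by
  have hn : (0 : ℝ) < n := Nat.cast_pos.mpr (Nat.pos_of_ne_zero (NeZero.ne n))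
  have hD := decays_Pgt_sup n ha
  have hδ : 0 < deltaPP 4 a / (4 * (n : ℝ)) := div_pos (deltaPP_pos 4 ha) (by positivity)
  refine Summable.of_nonneg_of_le (fun x => abs_nonneg _) (fun x => hD x q v v')
    ((summable_exp_shift' hδ q).mul_left _)

/-- [folklore] **M4′ — THE FINE-`ℓ¹` COLUMN OF THE PROJECTOR IS `n`-FREE**: `Σ'_x |Pgt n a x q| ≤ cPPs(4,a)·K₄(δ_PP(4,a))` (block regrouping
`NeedleRowLetters.tsum_eq_tsum_blocks` + §1 + `RProjector.abs_tsum_le_latticeConst`). -/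
theorem tsum_abs_Pgt_col_le_sup (ha : 0 < a) (q : X 4) (v v' : Unit) :
    ∑' x : X 4, |Pgt n a x q v v'| ≤ cPPs 4 a * latticeConst 4 (deltaPP 4 a) := by
  rw [tsum_eq_tsum_blocks (n - 1) (summable_abs_Pgt_col n ha q v v')]
  refine (le_abs_self _).trans (abs_tsum_le_latticeConst (deltaPP_pos 4 ha) (cPPs_nonneg 4 ha) (blk (n - 1) q) fun w => ?_)
  rw [abs_of_nonneg (Finset.sum_nonneg fun z _ => abs_nonneg _), dist_comm]
  exact sum_B_abs_Pgt_le_sup n ha q w v v'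

/-- [folklore] The left-difference column `x ↦ |Pgt n a (x+e_μ) q − Pgt n a x q|` is summable over `ℤ⁴`. -/
theorem summable_abs_Pgt_diff_col (ha : 0 < a) (q : X 4) (μ : Fin 4) (v v' : Unit) :
    Summable fun x : X 4 => |Pgt n a (x + e μ) q v v' - Pgt n a x q v v'| := by
  have h1 : Summable fun x : X 4 => |Pgt n a (x + e μ) q v v'| :=
    (summable_abs_Pgt_col n ha q v v').comp_injective (add_left_injective (e μ))
  have h2 := summable_abs_Pgt_col n ha q v v'
  exact Summable.of_nonneg_of_le (fun x => abs_nonneg _) (fun x => abs_sub _ _) (h1.add h2)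

/-- [folklore] **M4′ — THE FINE-`ℓ¹` COLUMN OF THE DIFFERENCE GAINS `n⁻¹`**: `Σ'_x |Pgt n a (x+e_μ) q − Pgt n a x q| ≤ (cPPs(4,a)∕n)·K₄(δ_PP(4,a))`. -/
theorem tsum_abs_Pgt_diff_col_le_sup (ha : 0 < a) (q : X 4) (μ : Fin 4) (v v' : Unit) :
    ∑' x : X 4, |Pgt n a (x + e μ) q v v' - Pgt n a x q v v'| ≤ cPPs 4 a / (n : ℝ) * latticeConst 4 (deltaPP 4 a) := by
  have hn : (0 : ℝ) < n := Nat.cast_pos.mpr (Nat.pos_of_ne_zero (NeZero.ne n))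
  rw [tsum_eq_tsum_blocks (n - 1) (summable_abs_Pgt_diff_col n ha q μ v v')]
  refine (le_abs_self _).trans (abs_tsum_le_latticeConst (deltaPP_pos 4 ha) (div_nonneg (cPPs_nonneg 4 ha) hn.le) (blk (n - 1) q)
    fun w => ?_)
  rw [abs_of_nonneg (Finset.sum_nonneg fun z _ => abs_nonneg _), dist_comm]
  exact sum_B_abs_Pgt_diff_le_sup n ha q w μ v v'

/-! ## §3 M5 — the `kerP` column and the corner entry with the `n`-free constant `cPs` -/

omit [NeZero n] in
/-- [folklore] **M5 — THE `kerP` COLUMN, SHARP**: `|kerP (n−1) a q w| ≤ cPs(4,a)·e^{−δ_P·dist(blk q, w)}` (`ProjectorSupNorm.abs_kerP_le_sup` in the road's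
block currency; replaces `CornerColumnZeroMass.abs_kerP_col_le`, whose `cP 4 (n−1) a ∝ n²`). -/
theorem abs_kerP_col_le_sup (ha : 0 < a) (q w : X 4) :
    |kerP (d := 4) (n - 1) a q w| ≤ cPs 4 a * Real.exp (-(deltaP 4 a * dist (blk (n - 1) q) w)) :=
  abs_kerP_le_sup (d := 4) (by norm_num) (n - 1) ha q w

/-- [folklore] **THE `kerP` COLUMN DIFFERENCE GAINS `n⁻¹`**: `|kerP (n−1) a (q+e_μ) w − kerP (n−1) a q w| ≤ (cPs(4,a)∕n)·e^{−δ_P·dist(blk q, w)}`. -/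
theorem abs_kerP_col_diff_le_sup (ha : 0 < a) (q w : X 4) (μ : Fin 4) :
    |kerP (d := 4) (n - 1) a (q + e μ) w - kerP (d := 4) (n - 1) a q w|
      ≤ cPs 4 a / (n : ℝ) * Real.exp (-(deltaP 4 a * dist (blk (n - 1) q) w)) := by
  have h := abs_kerP_diff_le_sup (d := 4) (by norm_num) (n - 1) ha q w μ
  rwa [cast_pred_add_one n] at h

variable (κ' : Fin 4) (u : Site 4)

/-- [folklore] **M5 — THE CORNER-ENTRY LETTER WITH THE `n`-FREE COLUMN CONSTANT**: `|cornerJ G P (Jq n a κ′ u) x q| ≤ M·(n^{κ′+1}·n⁻⁴)·cPs·e^{−δ_P·dist(blk q, blk u)}`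
for any bound `M` of `|(R∘G′)(x, ·)|` on the bond's block (`CornerJRankOne.abs_cornerJ_le` with `abs_kerP_le_sup` for `abs_kerP_le`). -/
theorem abs_cornerJ_le_sup (ha : 0 < a) (G P : MKer 4 Unit) (x q : Site 4) (v w : Unit) {M : ℝ}
    (hM : ∀ s ∈ B (n - 1) (blk (n - 1) u), |RG G P x s v ()| ≤ M) :
    |cornerJ G P (Jq n a κ' u) x q v w|
      ≤ M * ((n : ℝ) ^ ((κ' : ℕ) + 1) * ((n : ℝ) ^ 4)⁻¹) *
          (cPs 4 a * Real.exp (-(deltaP 4 a * dist (blk (n - 1) q) (blk (n - 1) u)))) := by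
  rw [cornerJ_apply_eq, abs_mul, abs_neg]
  exact mul_le_mul (abs_row_le n κ' u G P x v hM) (abs_kerP_col_le_sup n ha q (blk (n - 1) u)) (abs_nonneg _)
    ((abs_nonneg _).trans (abs_row_le n κ' u G P x v hM))

/-! ## §4 The combined column of the needle words (F-R3 of the `SbRblk` anatomy) -/

/-- [folklore] **THE COMBINED COLUMN IS BLOCK-LOCALISED WITH `n`-FREE CONSTANTS**: for every stencil weight `cQ`,
`|cQ·Σ_{z ∈ B(w)} Pgt n a z q − kerP (n−1) a q w| ≤ |cQ|·cPPs·e^{−δ_PP·dist(w, blk q)} + cPs·e^{−δ_P·dist(blk q, w)}`. -/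
theorem abs_combinedColumn_le_sup (ha : 0 < a) (cQ : ℝ) (q w : X 4) (v v' : Unit) :
    |cQ * (∑ z ∈ B (n - 1) w, Pgt n a z q v v') - kerP (d := 4) (n - 1) a q w|
      ≤ |cQ| * (cPPs 4 a * Real.exp (-(deltaPP 4 a * dist w (blk (n - 1) q))))
        + cPs 4 a * Real.exp (-(deltaP 4 a * dist (blk (n - 1) q) w)) := by
  calc |cQ * (∑ z ∈ B (n - 1) w, Pgt n a z q v v') - kerP (d := 4) (n - 1) a q w|
      ≤ |cQ * (∑ z ∈ B (n - 1) w, Pgt n a z q v v')| + |kerP (d := 4) (n - 1) a q w| := abs_sub _ _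
    _ ≤ _ := by
        rw [abs_mul]
        exact add_le_add (mul_le_mul_of_nonneg_left (abs_sum_B_Pgt_le_sup n ha q w v v') (abs_nonneg _))
          (abs_kerP_col_le_sup n ha q w)

/-- [folklore] **THE COMBINED COLUMN's `q`-DIFFERENCE GAINS `n⁻¹`** (the located `n⁻¹` of the needle words sits on THIS slot, an3-g56 §3 M8):
`|C_w(q + e_μ) − C_w(q)| ≤ |cQ|·(cPPs∕n)·e^{−δ_PP·dist(w, blk q)} + (cPs∕n)·e^{−δ_P·dist(blk q, w)}`. -/
theorem abs_combinedColumn_diff_le_sup (ha : 0 < a) (cQ : ℝ) (q w : X 4) (μ : Fin 4) (v v' : Unit) :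
    |(cQ * (∑ z ∈ B (n - 1) w, Pgt n a z (q + e μ) v v') - kerP (d := 4) (n - 1) a (q + e μ) w)
        - (cQ * (∑ z ∈ B (n - 1) w, Pgt n a z q v v') - kerP (d := 4) (n - 1) a q w)|
      ≤ |cQ| * (cPPs 4 a / (n : ℝ) * Real.exp (-(deltaPP 4 a * dist w (blk (n - 1) q))))
        + cPs 4 a / (n : ℝ) * Real.exp (-(deltaP 4 a * dist (blk (n - 1) q) w)) := by
  have hP : |∑ z ∈ B (n - 1) w, (Pgt n a z (q + e μ) v v' - Pgt n a z q v v')|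
      ≤ cPPs 4 a / (n : ℝ) * Real.exp (-(deltaPP 4 a * dist w (blk (n - 1) q))) :=
    (Finset.abs_sum_le_sum_abs _ _).trans (sum_B_abs_Pgt_diff_right_le_sup n ha q w μ v v')
  have hK := abs_kerP_col_diff_le_sup n ha q w μ
  have e1 : (cQ * (∑ z ∈ B (n - 1) w, Pgt n a z (q + e μ) v v') - kerP (d := 4) (n - 1) a (q + e μ) w)
        - (cQ * (∑ z ∈ B (n - 1) w, Pgt n a z q v v') - kerP (d := 4) (n - 1) a q w)
      = cQ * (∑ z ∈ B (n - 1) w, (Pgt n a z (q + e μ) v v' - Pgt n a z q v v'))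
        - (kerP (d := 4) (n - 1) a (q + e μ) w - kerP (d := 4) (n - 1) a q w) := by
    rw [Finset.sum_sub_distrib]; ring
  rw [e1]
  calc |cQ * (∑ z ∈ B (n - 1) w, (Pgt n a z (q + e μ) v v' - Pgt n a z q v v'))
          - (kerP (d := 4) (n - 1) a (q + e μ) w - kerP (d := 4) (n - 1) a q w)|
      ≤ |cQ * (∑ z ∈ B (n - 1) w, (Pgt n a z (q + e μ) v v' - Pgt n a z q v v'))|
          + |kerP (d := 4) (n - 1) a (q + e μ) w - kerP (d := 4) (n - 1) a q w| := abs_sub _ _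
    _ ≤ _ := by
        rw [abs_mul]
        exact add_le_add (mul_le_mul_of_nonneg_left hP (abs_nonneg _)) hK

end Summit.QuantumFields.BalabanUV.Beta.D1BFx.ProjectorColumnSharp

end
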